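/-
Copyright (c) 2026. All rights reserved.
Released under Apache 2.0 license as described in the file LICENSE.
-/
import Literature.NumberTheory.Automorphic.BrandtModuleSignSpacesCuspidal
import Literature.NumberTheory.Automorphic.BrandtMatrixDegree
import Literature.NumberTheory.Automorphic.BrandtModuleWeightSymmProofs
import HarnessLib

/-!
# `M(O) = ℚ e₀ ⊕ M(O)⁰` as Hecke modules: `T(n) e₀ = σ₁(n) e₀`, `deg ∘ T(n) = σ₁(n) deg`, and the sign spaces
# `M^χ(O) ∩ M(O)⁰` are Hecke-stable (Martin 2018, §3.3: `M_k(O) = E ⊕ S`, `M^χ = S^χ ⊕ ℂ𝟙` or `S^χ`)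

[tag: quaternion_algebra] [tag: eichler_order] [tag: hecke_operator]

Topic `NumberTheory/Automorphic`. Lane `lit-hodgefound`, seat p12, gen 52 — sequel of
`BrandtModuleSignSpacesCuspidal.lean` (`deg`, `e₀ ∈ M^{+_T}`, `χ ≠ + ⇒ M^χ ≤ ker deg`, `dim (M^{+_T} ∩ ker deg) = h_T − 1`),
with the Hecke input of `BrandtMatrixDegree.lean` (`∑_i T(n)_{ij} = σ₁(n)`, `n` prime to `N⁺N⁻`; Eichler) and
`BrandtModuleWeightSymmProofs.lean` (`w_i T(n)_{ij} = w_j T(n)_{ji}`).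

[Martin2018, §3.1 and §3.3]: the space of quaternionic forms is a Hecke module, "`𝟙 ∈ M_0(O)`" spans the Eisenstein
part `E` with `T_𝔭 𝟙 = (N(𝔭) + 1) 𝟙`, `S = E^⊥`, and "`M_k^χ(O) = S_k^χ(O) ⊕ ℂ𝟙` if `k = 0` and `χ = +_𝔑`; else
`M_k^χ(O) = S_k^χ(O)`". In the divisor coordinates of the tree (`T(n)` acting by `Matrix.toLin'`, Gross's `e₀ = (1/w_c)_c`
and `deg v = ∑_c v_c`, [Gross1987, §1–§2]), for a Brandt setup `S`, `n ≥ 1` prime to `N⁺N⁻`, a finite `T` and `χ`: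

* §1 **`degree_toLin_matrix`** (`deg (T(n) v) = σ₁(n) deg v`), `toLin_matrix_mem_ker_degree`, **`mapsTo_toLin_matrix_ker_degree`**
  (`M(O)⁰ = ker deg` is Hecke-stable), `degree_eq_zero_of_toLin_matrix_eq_smul` (an eigenvector with eigenvalue `≠ σ₁(n)`
  has degree zero);
* §2 ★ **`toLin_matrix_inv_weight`** (`T(n) e₀ = σ₁(n) e₀`: Gross's Eisenstein vector is a Hecke eigenvector with the
  Eisenstein eigenvalues), `inv_weight_mem_eigenspace`, `toLin_matrix_ramified_inv_weight` (`T(q) e₀ = e₀`, `q ∣ N⁻`);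
* §3 **`span_inv_weight_sup_ker_degree`** (`ℚ e₀ ⊔ ker deg = ⊤`), `disjoint_span_inv_weight_ker_degree`,
  **`isCompl_span_inv_weight_ker_degree`** (`M(O) = ℚ e₀ ⊕ M(O)⁰`);
* §4 ★ **`mapsTo_toLin_matrix_signSpace_inf_ker_degree`** (`S^χ(O) := M^χ(O) ∩ ker deg` is `T(n)`-stable),
  **`signSpace_one_eq_span_sup`** (`M^{+_T}(O) = ℚ e₀ ⊔ S^{+_T}(O)`, the sum direct), and for `χ ≠ +_T`:
  `signSpace_inf_ker_degree_eq` (`S^χ = M^χ`).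

## References

* [Martin2018] K. Martin, *Congruences for modular forms mod 2 and quaternionic `S`-ideal classes*, Canad. J. Math. 70
  (2018) (held: arXiv 1701.07864): §3.1, §3.3.
* [Gross1987] B. H. Gross, *Heights and the special values of L-series*, CMS Conf. Proc. 7 (1987), §1 (`deg t_m = σ(m)`,
  `e₀`), §2.
* [Eichler1973] M. Eichler, *The basis problem for modular forms and the traces of the Hecke operators*, LNM 320 (1973),
  Ch. II §6 (16)–(19).

## Scope (honest)

Only `n` prime to `N⁺N⁻` (and the ramified `T(q)`, `q ∣ N⁻`) are treated; weight `0`, `F = ℚ`. Theorems only; no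
definition, no named fact, no instance.
-/

noncomputable section

open scoped Pointwise
open ArithmeticFunction

namespace Literature.NumberTheory.Automorphic

namespace Brandt

variable {Nplus Nminus : ℕ} (S : XiSetup Nplus Nminus) [Fintype (ClassSet S.O)] [DecidableEq (ClassSet S.O)]

/-! ## §1 `deg ∘ T(n) = σ₁(n) · deg` -/

omit [DecidableEq (ClassSet S.O)] in
/-- The column sums of `T(n)` over `ℚ`: `∑_i T(n)_{ij} = σ₁(n)` (`n ≥ 1` prime to `N⁺N⁻`). [cite: Eichler1973, Ch. II §6 Thm. 2 Cor. 1] [cite: Gross1987, §1 (`deg t_m = σ(m)`)] -/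
theorem XiSetup.sum_map_matrix_eq_sigma {n : ℕ} (hn : n ≠ 0) (hcop : Nat.Coprime n (Nplus * Nminus)) (j : ClassSet S.O) :
    ∑ i, (matrix S.O n).map (Int.cast : ℤ → ℚ) i j = ((sigma 1 n : ℕ) : ℚ) := by
  have h := S.sum_matrix_eq_sigma hn hcop j
  have h' := congrArg (Int.cast : ℤ → ℚ) h
  rw [Int.cast_sum] at h'
  simpa only [Matrix.map_apply, Int.cast_natCast] using h'

/-- **`deg (T(n) v) = σ₁(n) · deg v`** for `n ≥ 1` prime to `N⁺N⁻` (the row vector `(1, …, 1)` is a left eigenvector of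
`T(n)` with eigenvalue `σ₁(n)`). [cite: Gross1987, §1–§2] [cite: Eichler1973, Ch. II §6 (16)] -/
theorem XiSetup.degree_toLin_matrix {n : ℕ} (hn : n ≠ 0) (hcop : Nat.Coprime n (Nplus * Nminus))
    (v : ClassSet S.O → ℚ) :
    S.degree (Matrix.toLin' ((matrix S.O n).map (Int.cast : ℤ → ℚ)) v) = ((sigma 1 n : ℕ) : ℚ) * S.degree v := by
  rw [Matrix.toLin'_apply, S.degree_apply, S.degree_apply]
  exact sum_mulVec_eq_mul_sum _ (fun j => S.sum_map_matrix_eq_sigma hn hcop j) v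

/-- `T(n)` maps `ker deg` into itself. [cite: Gross1987, §2] [cite: Martin2018, §3.1 (`S` is a Hecke submodule)] -/
theorem XiSetup.toLin_matrix_mem_ker_degree {n : ℕ} (hn : n ≠ 0) (hcop : Nat.Coprime n (Nplus * Nminus))
    {v : ClassSet S.O → ℚ} (hv : v ∈ LinearMap.ker S.degree) :
    Matrix.toLin' ((matrix S.O n).map (Int.cast : ℤ → ℚ)) v ∈ LinearMap.ker S.degree := by
  rw [LinearMap.mem_ker] at hv ⊢
  rw [S.degree_toLin_matrix hn hcop, hv, mul_zero]

/-- **The degree-zero part `M(O)⁰ = ker deg` is Hecke-stable** (`n ≥ 1` prime to `N⁺N⁻`). [cite: Martin2018, §3.1 and §3.3] [cite: Gross1987, §2] -/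
theorem XiSetup.mapsTo_toLin_matrix_ker_degree {n : ℕ} (hn : n ≠ 0) (hcop : Nat.Coprime n (Nplus * Nminus)) :
    Set.MapsTo (Matrix.toLin' ((matrix S.O n).map (Int.cast : ℤ → ℚ)))
      (LinearMap.ker S.degree : Set (ClassSet S.O → ℚ)) (LinearMap.ker S.degree) :=
  fun _ hv => S.toLin_matrix_mem_ker_degree hn hcop hv

/-- **An eigenvector of `T(n)` with eigenvalue `≠ σ₁(n)` has degree zero.** [cite: Gross1987, §2] -/
theorem XiSetup.degree_eq_zero_of_toLin_matrix_eq_smul {n : ℕ} (hn : n ≠ 0) (hcop : Nat.Coprime n (Nplus * Nminus))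
    {v : ClassSet S.O → ℚ} {μ : ℚ} (hv : Matrix.toLin' ((matrix S.O n).map (Int.cast : ℤ → ℚ)) v = μ • v)
    (hμ : μ ≠ ((sigma 1 n : ℕ) : ℚ)) : S.degree v = 0 := by
  have h := S.degree_toLin_matrix hn hcop v
  rw [hv, map_smul, smul_eq_mul] at h
  have h2 : (μ - ((sigma 1 n : ℕ) : ℚ)) * S.degree v = 0 := by rw [sub_mul, h, sub_self]
  rcases mul_eq_zero.mp h2 with h3 | h3
  · exact absurd (sub_eq_zero.mp h3) hμ
  · exact h3

/-! ## §2 `T(n) e₀ = σ₁(n) e₀` -/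

/-- **Gross's Eisenstein vector is a Hecke eigenvector with the Eisenstein eigenvalues: `T(n) e₀ = σ₁(n) e₀`**, `e₀ = (1/w_c)_c`,
`n ≥ 1` prime to `N⁺N⁻` (weight symmetry `w_i T_{ij} = w_j T_{ji}` turns the column sums `σ₁(n)` into this eigen-relation).
[cite: Gross1987, §1 (`e₀ = Σ e_i/w_i`, `deg t_m = σ(m)`) and §2] [cite: Martin2018, §3.1 (`T_𝔭 𝟙`)] -/
theorem XiSetup.toLin_matrix_inv_weight {n : ℕ} (hn : n ≠ 0) (hcop : Nat.Coprime n (Nplus * Nminus)) :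
    Matrix.toLin' ((matrix S.O n).map (Int.cast : ℤ → ℚ)) (fun c => ((weight S.O c : ℚ))⁻¹) =
      ((sigma 1 n : ℕ) : ℚ) • fun c => ((weight S.O c : ℚ))⁻¹ := by
  funext i
  rw [Matrix.toLin'_apply, Matrix.mulVec, dotProduct, Pi.smul_apply, smul_eq_mul]
  have hw : ∀ c : ClassSet S.O, (weight S.O c : ℚ) ≠ 0 := fun c =>
    Nat.cast_ne_zero.mpr (Nat.one_le_iff_ne_zero.mp (S.one_le_weight c))
  -- `T_{ij} / w_j = T_{ji} / w_i`
  have hsymm : ∀ j : ClassSet S.O, (matrix S.O n).map (Int.cast : ℤ → ℚ) i j * ((weight S.O j : ℚ))⁻¹ =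
      ((weight S.O i : ℚ))⁻¹ * (matrix S.O n).map (Int.cast : ℤ → ℚ) j i := fun j => by
    have h := congrArg (Int.cast : ℤ → ℚ) (S.weight_mul_matrix_symm n i j)
    simp only [Int.cast_mul, Int.cast_natCast] at h
    rw [Matrix.map_apply, Matrix.map_apply]
    calc ((matrix S.O n i j : ℤ) : ℚ) * ((weight S.O j : ℚ))⁻¹
        = ((weight S.O i : ℚ))⁻¹ * ((weight S.O i : ℚ) * ((matrix S.O n i j : ℤ) : ℚ)) * ((weight S.O j : ℚ))⁻¹ := by
          rw [← mul_assoc, inv_mul_cancel₀ (hw i), one_mul]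
      _ = ((weight S.O i : ℚ))⁻¹ * ((weight S.O j : ℚ) * ((matrix S.O n j i : ℤ) : ℚ)) * ((weight S.O j : ℚ))⁻¹ := by
          rw [h]
      _ = ((weight S.O i : ℚ))⁻¹ * ((matrix S.O n j i : ℤ) : ℚ) := by
          rw [mul_comm (weight S.O j : ℚ), mul_assoc, mul_assoc, mul_inv_cancel₀ (hw j), mul_one]
  simp_rw [hsymm]
  rw [← Finset.mul_sum, S.sum_map_matrix_eq_sigma hn hcop i, mul_comm]

/-- `e₀` lies in the `σ₁(n)`-eigenspace of `T(n)`. [cite: Gross1987, §2] -/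
theorem XiSetup.inv_weight_mem_eigenspace {n : ℕ} (hn : n ≠ 0) (hcop : Nat.Coprime n (Nplus * Nminus)) :
    (fun c : ClassSet S.O => ((weight S.O c : ℚ))⁻¹) ∈
      Module.End.eigenspace (Matrix.toLin' ((matrix S.O n).map (Int.cast : ℤ → ℚ))) ((sigma 1 n : ℕ) : ℚ) :=
  Module.End.mem_eigenspace_iff.mpr (S.toLin_matrix_inv_weight hn hcop)

/-- At a ramified prime `q ∣ N⁻`: `T(q) e₀ = e₀` (`T(q)` is the permutation matrix of `W_{q⁻}`, and the weights are
`W`-invariant). [cite: Martin2018, §3.1 (`T_𝔭 𝟙 = 𝟙` for `𝔭 ∣ 𝔑`)] [cite: Gross1987, §1] -/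
theorem XiSetup.toLin_matrix_ramified_inv_weight {q : ℕ} [Fact q.Prime] (hq : q ∣ Nminus) :
    Matrix.toLin' ((matrix S.O q).map (Int.cast : ℤ → ℚ)) (fun c => ((weight S.O c : ℚ))⁻¹) =
      fun c => ((weight S.O c : ℚ))⁻¹ := by
  funext c
  rw [Matrix.toLin'_apply, S.map_matrix_ramified_mulVec_of_dvd hq, ← S.atkinLehner_of_dvd hq, S.weight_atkinLehner]

/-! ## §3 `M(O) = ℚ e₀ ⊕ M(O)⁰` -/

omit [DecidableEq (ClassSet S.O)] in
/-- **`ℚ e₀ ⊔ ker deg = ⊤`** (`deg e₀ > 0`). [cite: Gross1987, §1–§2] [cite: Martin2018, §3.3 (`M = E ⊕ S`)] -/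
theorem XiSetup.span_inv_weight_sup_ker_degree :
    (ℚ ∙ fun c : ClassSet S.O => ((weight S.O c : ℚ))⁻¹) ⊔ LinearMap.ker S.degree = ⊤ :=
  LinearMap.span_singleton_sup_ker_eq_top S.degree (ne_of_gt S.degree_inv_weight_pos)

omit [DecidableEq (ClassSet S.O)] in
/-- `ℚ e₀ ∩ ker deg = 0`. [cite: Gross1987, §1–§2] -/
theorem XiSetup.disjoint_span_inv_weight_ker_degree :
    Disjoint (ℚ ∙ fun c : ClassSet S.O => ((weight S.O c : ℚ))⁻¹) (LinearMap.ker S.degree) := by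
  rw [Submodule.disjoint_def]
  intro v hv hv0
  obtain ⟨a, rfl⟩ := Submodule.mem_span_singleton.mp hv
  rw [LinearMap.mem_ker, map_smul, smul_eq_mul] at hv0
  rcases mul_eq_zero.mp hv0 with h | h
  · rw [h, zero_smul]
  · exact absurd h (ne_of_gt S.degree_inv_weight_pos)

omit [DecidableEq (ClassSet S.O)] in
/-- **`M(O) = ℚ e₀ ⊕ M(O)⁰`**: the Eisenstein line and the degree-zero part are complementary (and both Hecke-stable, §1–§2).
[cite: Martin2018, §3.3 (`M_0(O) = E ⊕ S`)] [cite: Gross1987, §2] -/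
theorem XiSetup.isCompl_span_inv_weight_ker_degree :
    IsCompl (ℚ ∙ fun c : ClassSet S.O => ((weight S.O c : ℚ))⁻¹) (LinearMap.ker S.degree) :=
  ⟨S.disjoint_span_inv_weight_ker_degree, codisjoint_iff.mpr S.span_inv_weight_sup_ker_degree⟩

/-! ## §4 The cuspidal sign spaces `S^χ(O) = M^χ(O) ∩ ker deg` are Hecke-stable -/

variable (T : Finset ℕ)

/-- **`S^χ(O) := M^χ(O) ∩ ker deg` is `T(n)`-stable** (`n ≥ 1` prime to `N⁺N⁻`). [cite: Martin2018, §3.3 (`S_k^χ(O)` a Hecke module)] -/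
theorem XiSetup.mapsTo_toLin_matrix_signSpace_inf_ker_degree {n : ℕ} (hn : n ≠ 0) (hcop : Nat.Coprime n (Nplus * Nminus))
    (χ : T → ℤˣ) :
    Set.MapsTo (Matrix.toLin' ((matrix S.O n).map (Int.cast : ℤ → ℚ)))
      (↑(S.signSpace T χ ⊓ LinearMap.ker S.degree) : Set (ClassSet S.O → ℚ)) ↑(S.signSpace T χ ⊓ LinearMap.ker S.degree) := by
  intro v hv
  rw [SetLike.mem_coe, Submodule.mem_inf] at hv ⊢
  exact ⟨S.mapsTo_toLin_matrix_signSpace T χ n hv.1, S.toLin_matrix_mem_ker_degree hn hcop hv.2⟩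

omit [DecidableEq (ClassSet S.O)] in
/-- For `χ ≠ +_T`: `S^χ(O) = M^χ(O)` (`M^χ ≤ ker deg`). [cite: Martin2018, §3.3 ("else `M_k^χ(O) = S_k^χ(O)`")] -/
theorem XiSetup.signSpace_inf_ker_degree_eq {χ : T → ℤˣ} (hχ : χ ≠ 1) :
    S.signSpace T χ ⊓ LinearMap.ker S.degree = S.signSpace T χ :=
  inf_eq_left.mpr (S.signSpace_le_ker_degree hχ)

omit [DecidableEq (ClassSet S.O)] in
/-- **`M^{+_T}(O) = ℚ e₀ ⊔ S^{+_T}(O)`** (`e₀ ∈ M^{+_T}`; "`M^χ = S^χ ⊕ ℂ𝟙` for `χ = +`"). [cite: Martin2018, §3.3] [cite: Gross1987, §1] -/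
theorem XiSetup.signSpace_one_eq_span_sup :
    S.signSpace T 1 = (ℚ ∙ fun c : ClassSet S.O => ((weight S.O c : ℚ))⁻¹) ⊔ (S.signSpace T 1 ⊓ LinearMap.ker S.degree) := by
  apply le_antisymm
  · intro v hv
    have htop : v ∈ (ℚ ∙ fun c : ClassSet S.O => ((weight S.O c : ℚ))⁻¹) ⊔ LinearMap.ker S.degree := by
      rw [S.span_inv_weight_sup_ker_degree]; exact Submodule.mem_top
    obtain ⟨y, hy, z, hz, rfl⟩ := Submodule.mem_sup.mp htop
    refine Submodule.mem_sup.mpr ⟨y, hy, z, ⟨?_, hz⟩, rfl⟩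
    -- `z = v - y` with `v, y ∈ M^{+_T}`
    have hy' : y ∈ S.signSpace T 1 := by
      obtain ⟨a, rfl⟩ := Submodule.mem_span_singleton.mp hy
      exact Submodule.smul_mem _ a (S.inv_weight_mem_signSpace_one T)
    have : z = (y + z) - y := by abel
    rw [this]
    exact Submodule.sub_mem _ hv hy'
  · exact sup_le (Submodule.span_le.mpr (Set.singleton_subset_iff.mpr (S.inv_weight_mem_signSpace_one T))) inf_le_left

omit [DecidableEq (ClassSet S.O)] in
/-- The sum `ℚ e₀ ⊔ S^{+_T}(O)` is direct. [cite: Martin2018, §3.3] -/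
theorem XiSetup.disjoint_span_inv_weight_signSpace_one_inf :
    Disjoint (ℚ ∙ fun c : ClassSet S.O => ((weight S.O c : ℚ))⁻¹) (S.signSpace T 1 ⊓ LinearMap.ker S.degree) :=
  S.disjoint_span_inv_weight_ker_degree.mono_right inf_le_right

omit [DecidableEq (ClassSet S.O)] in
/-- Dimension check: `1 + dim S^{+_T}(O) = dim M^{+_T}(O) = h_T`. [cite: Martin2018, (3.9)] -/
theorem XiSetup.finrank_signSpace_one_eq_one_add :
    Module.finrank ℚ (S.signSpace T 1) = 1 + Module.finrank ℚ ↥(S.signSpace T 1 ⊓ LinearMap.ker S.degree) := by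
  have h := S.finrank_signSpace_one_inf_ker_degree T
  rw [← S.finrank_signSpace_one_eq_natCard_sClassSet T] at h
  omega

end Brandt

end Literature.NumberTheory.Automorphic
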